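import Literature.NumberTheory.PAdicHodge.BmaxPlusTheta
import Literature.NumberTheory.PAdicHodge.WittFrobeniusCongruence
import Mathlib.FieldTheory.Finite.Basic
import Mathlib.RingTheory.PrincipalIdealDomain
import HarnessLib

/-!
# `(A_max)^{φ=1} = ℤ_p`: the Frobenius-fixed elements of Colmez's `A_max = B_max⁺(F)`

Topic `Literature/NumberTheory/PAdicHodge`; namespace `Literature.NumberTheory.PAdicHodge`. THEOREMS ONLY (no definition, no named
fact, no instance). Continuation of `BmaxZero` / `BmaxPlus` / `BmaxPlusLog`: `A_max = BmaxPlus F p` is the `p`-adic completion of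
`B⁰_max = 𝔸_inf[ξ/p]` with Frobenius `φ = frobBmaxPlus`. Main result:

* ★★ `exists_eq_ainfToBmaxPlus_zpToAinf_of_frobBmaxPlus_eq` — **`(A_max)^{φ=1} = ℤ_p`**: if `x ∈ A_max` and `φ(x) = x` then
  `x = ι(c)` for a (unique) `c ∈ ℤ_p` (`ι : ℤ_p → 𝔸_inf → A_max`).

Proof (levelwise, `p`-adic): on `B⁰_max`, `φ(ξ/p) = p^{p-1}(ξ/p)^p + m ∈ 𝔸_inf + p·B⁰_max`, hence `φ(B⁰_max) ⊆ 𝔸_inf + p·B⁰_max`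
(`exists_frobBmaxZero_eq_algebraMap_add`); so `φ(y) ≡ y (mod p)` forces `y ≡ b ∈ 𝔸_inf (mod p)` with `φ(b) − b ∈ 𝔸_inf ∩ p·B⁰_max = (p, ξ)`,
i.e. `θ(b)^p ≡ θ(b) (mod p𝒪_{ℂ_F})` (`φ` lifts Frobenius), whence `θ(b) ≡ r (mod p)` for an integer `0 ≤ r < p` — the elementary
`𝒪_{ℂ_F}`-lemma `exists_nat_sub_natCast_mem_span_of_pow_sub_mem` (`X^p − X = ∏_{r ∈ 𝔽_p}(X − r)` and the ultrametric inequality: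
at most one factor `θ(b) − r` is a non-unit) — and `y ≡ r (mod p·B⁰_max)` (`ker θ = (ξ)`, `ξ = p·(ξ/p)`). Induction on the level
(`exists_natCast_sub_mem_pow_of_frobBmaxZero_sub_mem`: `φ(y) ≡ y (mod pⁿ) ⇒ y ≡ rₙ ∈ ℕ (mod pⁿ)`), `p·B⁰_max ∩ ℤ = pℤ`
(`natCast_mem_span_bmaxZero_iff`), and a `p`-adic limit in `ℤ_p` give the theorem. (`𝔸_inf ∩ p·B⁰_max = (p, ξ)` is
`BmaxPlusTheta.mem_span_p_xi_of_algebraMap_mem`.)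

This is Lemma "`A_max^{φ=1} = ℤ_p`" of the φ-road of line `kato_lever` (crux K★ `stmt-BirchSwinnertonDyer-22226`, memo
`Cruxes/StarredOptimalManinUnitFiveSeven/Lines/kato-lever-K2-phi-road.md`, brick B7: with Fontaine's lemma it gives
`(A_max)^{φ=p} ∩ ker θ ⊆ ℚ_p·t`). Infrastructure only: BSD / K★ are not proved by any of this.

## References
* [Colmez1998Annals] P. Colmez, *Théorie d'Iwasawa des représentations de de Rham d'un corps local*, Ann. of Math. 148 (1998),
  §III.2–III.3 (`A_max`, `φ`, `A_max^{φ=1} = ℤ_p`).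
* [FontaineAsterisque223III] J.-M. Fontaine, *Le corps des périodes p-adiques*, Astérisque 223 (1994), Exp. II §1.2, Exp. III §5.3
  (`(B_cris^+)^{φ=1} = ℚ_p`).
* [BergerLaurent2002] L. Berger, *Représentations p-adiques et équations différentielles*, Invent. Math. 148 (2002), §1.2.
-/

noncomputable section

open WittVector Field ValuativeRel Polynomial Finset
open Literature.AlgebraicGeometry.Resolution

namespace Literature.NumberTheory.PAdicHodge

open Literature.NumberTheory.GaloisRepresentations
open Literature.NumberTheory.GaloisRepresentations.IsNonarchimedeanLocalField

/-! ### An `𝒪_{ℂ_F}`-lemma: `γ^p ≡ γ (mod p) ⇒ γ ≡ r (mod p)` for an integer `0 ≤ r < p` -/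

section IntegerC

variable {F : Type} [Field F] [ValuativeRel F] [TopologicalSpace F] [IsNonarchimedeanLocalField F]
  [CharZero F] {p : ℕ} [Fact p.Prime] [Fact (¬ IsUnit (p : integerC F))]

/-- `X^p − X = ∏_{a ∈ 𝔽_p} (X − a)` in `𝔽_p[X]`. [folklore] -/
private theorem X_pow_sub_X_eq_prod :
    (X ^ p - X : (ZMod p)[X]) = ∏ a : ZMod p, (X - C a) := by
  have hp1 : 1 < p := (Fact.out : p.Prime).one_lt
  have hmonic : (X ^ p - X : (ZMod p)[X]).Monic :=
    Polynomial.monic_X_pow_sub (by rw [degree_X]; exact_mod_cast hp1)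
  have hroots : (X ^ p - X : (ZMod p)[X]).roots = Finset.univ.val := by
    have h := FiniteField.roots_X_pow_card_sub_X (ZMod p)
    rwa [ZMod.card] at h
  have hcard : Multiset.card (X ^ p - X : (ZMod p)[X]).roots = (X ^ p - X : (ZMod p)[X]).natDegree := by
    rw [hroots, FiniteField.X_pow_card_sub_X_natDegree_eq _ hp1, ← Finset.card_def, Finset.card_univ, ZMod.card]
  rw [← Polynomial.prod_multiset_X_sub_C_of_monic_of_roots_card_eq hmonic hcard, hroots, Finset.prod_eq_multiset_prod]

omit [CharZero F] in
/-- `γ^p − γ ≡ ∏_{r < p} (γ − r) (mod p)` in `𝒪_{ℂ_F}` (reduction of the `𝔽_p[X]`-identity). [folklore] -/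
private theorem prod_sub_natCast_mem_span_iff (γ : integerC F) :
    ∏ a : ZMod p, (γ - (a.val : integerC F)) ∈ Ideal.span {(p : integerC F)} ↔ γ ^ p - γ ∈ Ideal.span {(p : integerC F)} := by
  -- reduce modulo `p`: `𝒪_{ℂ_F}/p` is an `𝔽_p`-algebra
  let π : integerC F →+* ModP (integerC F) p := Ideal.Quotient.mk _
  let c : ZMod p →+* ModP (integerC F) p := ZMod.castHom (dvd_refl p) (ModP (integerC F) p)
  have key : π (∏ a : ZMod p, (γ - (a.val : integerC F))) = π (γ ^ p - γ) := by
    have h := congrArg (fun q : (ZMod p)[X] => (q.map c).eval (π γ)) (X_pow_sub_X_eq_prod (p := p))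
    simp only [Polynomial.map_sub, Polynomial.map_pow, map_X, eval_sub, eval_pow, eval_X, Polynomial.map_prod, map_C,
      eval_prod, eval_C] at h
    rw [map_sub, map_pow, h, map_prod]
    refine Finset.prod_congr rfl fun a _ => ?_
    rw [map_sub, map_natCast]
    congr 1
    change ((a.val : ℕ) : ModP (integerC F) p) = ZMod.castHom (dvd_refl p) (ModP (integerC F) p) a
    rw [ZMod.castHom_apply, ZMod.cast_eq_val]
  rw [← Ideal.Quotient.eq_zero_iff_mem, ← Ideal.Quotient.eq_zero_iff_mem]
  change π _ = 0 ↔ π _ = 0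
  rw [key]

omit [Fact p.Prime] [CharZero F] in
/-- `‖m‖ = 1` in `ℂ_F` for an integer `m` prime to `p` (Bezout). [folklore] -/
private theorem norm_intCast_C_eq_one {m : ℤ} (hm : IsCoprime (p : ℤ) m) : ‖(m : CompletedAlgClosure F)‖ = 1 := by
  refine le_antisymm (IsUltrametricDist.norm_intCast_le_one _ m) ?_
  by_contra hlt
  push Not at hlt
  obtain ⟨a, b, hab⟩ := hm
  have h1 : (1 : CompletedAlgClosure F) = (a : CompletedAlgClosure F) * (p : CompletedAlgClosure F) + (b : CompletedAlgClosure F) * m := by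
    exact_mod_cast congrArg (fun z : ℤ => (z : CompletedAlgClosure F)) hab.symm
  have hlt1 : ‖(a : CompletedAlgClosure F) * (p : CompletedAlgClosure F) + (b : CompletedAlgClosure F) * m‖ < 1 := by
    refine (IsUltrametricDist.norm_add_le_max _ _).trans_lt (max_lt ?_ ?_)
    · rw [norm_mul]
      exact (mul_le_of_le_one_left (norm_nonneg _) (IsUltrametricDist.norm_intCast_le_one _ a)).trans_lt norm_natCast_C_lt_one'
    · rw [norm_mul]
      exact (mul_le_of_le_one_left (norm_nonneg _) (IsUltrametricDist.norm_intCast_le_one _ b)).trans_lt hlt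
  rw [← h1, norm_one] at hlt1
  exact lt_irrefl _ hlt1

omit [CharZero F] in
/-- Two distinct residues `a ≠ b ∈ 𝔽_p` cannot both be within distance `< 1` of `γ` (their difference is a unit). [folklore] -/
private theorem eq_of_norm_sub_natCast_lt_one {γ : CompletedAlgClosure F} {a b : ZMod p}
    (ha : ‖γ - (a.val : CompletedAlgClosure F)‖ < 1) (hb : ‖γ - (b.val : CompletedAlgClosure F)‖ < 1) : a = b := by
  by_contra hab
  have hcop : IsCoprime (p : ℤ) ((b.val : ℤ) - a.val) := by
    refine (Nat.prime_iff_prime_int.1 Fact.out).coprime_iff_not_dvd.2 fun h => hab ?_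
    have h' : ((b.val : ℤ) : ZMod p) = ((a.val : ℤ) : ZMod p) :=
      ((ZMod.intCast_eq_intCast_iff_dvd_sub _ _ p).2 h).symm
    simpa [ZMod.natCast_val, ZMod.cast_id] using h'.symm
  have h1 := norm_intCast_C_eq_one (F := F) hcop
  have h2 : (((b.val : ℤ) - a.val : ℤ) : CompletedAlgClosure F) =
      (γ - (a.val : CompletedAlgClosure F)) - (γ - (b.val : CompletedAlgClosure F)) := by push_cast; ring
  rw [h2] at h1
  have h3 : ‖(γ - (a.val : CompletedAlgClosure F)) - (γ - (b.val : CompletedAlgClosure F))‖ ≤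
      max ‖γ - (a.val : CompletedAlgClosure F)‖ ‖γ - (b.val : CompletedAlgClosure F)‖ := by
    rw [sub_eq_add_neg (γ - (a.val : CompletedAlgClosure F))]
    exact (IsUltrametricDist.norm_add_le_max _ _).trans (by rw [norm_neg])
  rw [h1] at h3
  exact absurd h3 (not_le.2 (max_lt ha hb))

/-- **`γ^p ≡ γ (mod p𝒪_{ℂ_F}) ⇒ γ ≡ r (mod p𝒪_{ℂ_F})` for some integer `0 ≤ r < p`**: `∏_{r ∈ 𝔽_p}(γ − r) ∈ p𝒪_{ℂ_F}`, all factors have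
norm `≤ 1` and at most one has norm `< 1` (ultrametric inequality), so that factor has norm `≤ ‖p‖`. (The roots of `X^p − X` in the
residue field of `𝒪_{ℂ_F}` are the elements of `𝔽_p`.) [cite: FontaineAsterisque223III, Exp. II §1.2] -/
theorem exists_nat_sub_natCast_mem_span_of_pow_sub_mem (γ : integerC F) (h : γ ^ p - γ ∈ Ideal.span {(p : integerC F)}) :
    ∃ r : ℕ, r < p ∧ γ - (r : integerC F) ∈ Ideal.span {(p : integerC F)} := by
  have hp0 : (p : CompletedAlgClosure F) ≠ 0 := natCast_C_ne_zero (Fact.out : p.Prime).ne_zero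
  have hp0' : ((p : integerC F) : CompletedAlgClosure F) ≠ 0 := by rw [coe_natCast_integerC]; exact hp0
  have hprod := (prod_sub_natCast_mem_span_iff γ).2 h
  rw [← pow_one (Ideal.span {(p : integerC F)}), mem_span_pow_iff hp0' 1, pow_one, coe_natCast_integerC] at hprod
  -- norms of the factors
  have hcoe : ∀ a : ZMod p, ((γ - (a.val : integerC F) : integerC F) : CompletedAlgClosure F) =
      (γ : CompletedAlgClosure F) - (a.val : CompletedAlgClosure F) := fun a => by
    rw [AddSubgroupClass.coe_sub, Subring.coe_natCast]
  have hprodcoe : ((∏ b : ZMod p, (γ - (b.val : integerC F)) : integerC F) : CompletedAlgClosure F) =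
      ∏ b : ZMod p, ((γ - (b.val : integerC F) : integerC F) : CompletedAlgClosure F) := map_prod (integerC F).subtype _ _
  have hle : ∀ a : ZMod p, ‖((γ - (a.val : integerC F) : integerC F) : CompletedAlgClosure F)‖ ≤ 1 := fun a => (γ - _).2
  -- some factor has norm `< 1`
  by_cases hex : ∃ a : ZMod p, ‖((γ - (a.val : integerC F) : integerC F) : CompletedAlgClosure F)‖ < 1
  · obtain ⟨a, ha⟩ := hex
    refine ⟨a.val, a.val_lt, ?_⟩
    rw [← pow_one (Ideal.span {(p : integerC F)}), mem_span_pow_iff hp0' 1, pow_one, coe_natCast_integerC]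
    -- all the other factors have norm `1`
    have hone : ∀ b : ZMod p, b ≠ a → ‖((γ - (b.val : integerC F) : integerC F) : CompletedAlgClosure F)‖ = 1 := by
      intro b hb
      refine le_antisymm (hle b) (not_lt.1 fun hb1 => hb (eq_of_norm_sub_natCast_lt_one (p := p) (γ := (γ : CompletedAlgClosure F)) ?_ ?_))
      · rwa [hcoe] at hb1
      · rwa [hcoe] at ha
    have hnorm : ‖((∏ b : ZMod p, (γ - (b.val : integerC F)) : integerC F) : CompletedAlgClosure F)‖ =
        ‖((γ - (a.val : integerC F) : integerC F) : CompletedAlgClosure F)‖ := by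
      rw [hprodcoe, norm_prod, ← Finset.mul_prod_erase _ _ (Finset.mem_univ a),
        Finset.prod_eq_one fun b hb => hone b (Finset.ne_of_mem_erase hb), mul_one]
    rw [← hnorm]
    exact hprod
  · -- impossible: then the product is a unit, but it is divisible by `p`
    exfalso
    push Not at hex
    have hone : ∀ b : ZMod p, ‖((γ - (b.val : integerC F) : integerC F) : CompletedAlgClosure F)‖ = 1 :=
      fun b => le_antisymm (hle b) (hex b)
    have hnorm : ‖((∏ b : ZMod p, (γ - (b.val : integerC F)) : integerC F) : CompletedAlgClosure F)‖ = 1 := by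
      rw [hprodcoe, norm_prod, Finset.prod_eq_one fun b _ => hone b]
    rw [hnorm] at hprod
    exact absurd hprod (not_le.2 norm_natCast_C_lt_one')

end IntegerC

/-! ### `θ(a) ∈ p𝒪_{ℂ_F} ⇒ a ∈ (p, ξ)` -/

variable {F : Type} [Field F] [ValuativeRel F] [TopologicalSpace F] [IsNonarchimedeanLocalField F]
  [CharZero F] {p : ℕ} [Fact p.Prime] [Fact (¬ IsUnit (p : integerC F))]
  [IsAdicComplete (Ideal.span {(p : integerC F)}) (integerC F)]

/-- **`θ(a) ∈ p𝒪_{ℂ_F} ⇒ a ∈ (p, ξ)`** (`θ` surjective with kernel `ξ𝔸_inf`). [cite: FontaineAsterisque223III, Exp. II Prop. 1.2.3] -/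
theorem mem_span_p_xi_of_fontaineTheta_mem (hF : Function.Surjective (fontaineTheta (integerC F) p)) {a : Ainf (p := p) F}
    (ha : fontaineTheta (integerC F) p a ∈ Ideal.span {(p : integerC F)}) : a ∈ Ideal.span {(p : Ainf (p := p) F), xi} := by
  obtain ⟨c, hc⟩ := Ideal.mem_span_singleton'.1 ha
  obtain ⟨a', ha'⟩ := hF c
  have h0 : fontaineTheta (integerC F) p (a - a' * (p : Ainf (p := p) F)) = 0 := by
    rw [map_sub, map_mul, map_natCast, ha', hc, sub_self]
  obtain ⟨d, hd⟩ := xi_dvd_of_fontaineTheta_eq_zero h0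
  exact Ideal.mem_span_pair.2 ⟨a', d, by linear_combination -hd⟩

omit [CharZero F] in
/-- `θ` maps `(p, ξ)` into `p𝒪_{ℂ_F}`. [folklore] -/
private theorem fontaineTheta_mem_span_of_mem_span_p_xi {a : Ainf (p := p) F} (ha : a ∈ Ideal.span {(p : Ainf (p := p) F), xi}) :
    fontaineTheta (integerC F) p a ∈ Ideal.span {(p : integerC F)} := by
  obtain ⟨u, v, rfl⟩ := Ideal.mem_span_pair.1 ha
  rw [map_add, map_mul, map_mul, fontaineTheta_xi, mul_zero, add_zero, map_natCast]
  exact Ideal.mul_mem_left _ _ (Ideal.mem_span_singleton_self _)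

/-- **`p·B⁰_max ∩ ℤ = pℤ`**: an integer `m` is divisible by `p` in `B⁰_max` iff `p ∣ m` (Bezout: otherwise `1 ∈ p·B⁰_max`, i.e. `1 ∈ (p, ξ)`).
[cite: Colmez1998Annals, §III.2] -/
theorem intCast_mem_span_bmaxZero_iff (hF : Function.Surjective (fontaineTheta (integerC F) p)) (m : ℤ) :
    (m : bmaxZero F p) ∈ Ideal.span {(p : bmaxZero F p)} ↔ (p : ℤ) ∣ m := by
  constructor
  · intro hm
    by_contra hndvd
    obtain ⟨a, b, hab⟩ := ((Nat.prime_iff_prime_int.1 Fact.out).coprime_iff_not_dvd.2 hndvd)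
    have h1 : (1 : bmaxZero F p) ∈ Ideal.span {(p : bmaxZero F p)} := by
      have : (1 : bmaxZero F p) = (a : bmaxZero F p) * p + (b : bmaxZero F p) * m := by exact_mod_cast congrArg (fun z : ℤ => (z : bmaxZero F p)) hab.symm
      rw [this]
      exact Ideal.add_mem _ (Ideal.mul_mem_left _ _ (Ideal.mem_span_singleton_self _)) (Ideal.mul_mem_left _ _ hm)
    exact one_not_mem_span_p_xi (F := F) (p := p) (mem_span_p_xi_of_algebraMap_mem hF (by rwa [map_one]))
  · rintro ⟨k, rfl⟩
    rw [Int.cast_mul, Int.cast_natCast]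
    exact Ideal.mul_mem_right _ _ (Ideal.mem_span_singleton_self _)

/-- **`pⁿ·B⁰_max ∩ ℤ = pⁿℤ`.** [cite: Colmez1998Annals, §III.2] -/
theorem intCast_mem_span_bmaxZero_pow_iff (hF : Function.Surjective (fontaineTheta (integerC F) p)) (n : ℕ) (m : ℤ) :
    (m : bmaxZero F p) ∈ Ideal.span {(p : bmaxZero F p)} ^ n ↔ (p : ℤ) ^ n ∣ m := by
  induction n generalizing m with
  | zero => simp
  | succ n ih =>
    constructor
    · intro hm
      have hm1 : (m : bmaxZero F p) ∈ Ideal.span {(p : bmaxZero F p)} :=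
        Ideal.pow_le_self (I := Ideal.span {(p : bmaxZero F p)}) (Nat.succ_ne_zero n) hm
      obtain ⟨k, rfl⟩ := (intCast_mem_span_bmaxZero_iff hF m).1 hm1
      rw [Ideal.span_singleton_pow, Ideal.mem_span_singleton'] at hm
      obtain ⟨w, hw⟩ := hm
      have hk : (k : bmaxZero F p) ∈ Ideal.span {(p : bmaxZero F p)} ^ n := by
        rw [Ideal.span_singleton_pow, Ideal.mem_span_singleton']
        refine ⟨w, eq_of_natCast_pow_mul_eq (p := p) (F := F) (v := 1) ?_⟩
        push_cast at hw
        rw [pow_one]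
        linear_combination hw
      obtain ⟨j, rfl⟩ := (ih k).1 hk
      exact ⟨j, by ring⟩
    · rintro ⟨k, rfl⟩
      rw [Int.cast_mul, Int.cast_pow, Int.cast_natCast]
      exact Ideal.mul_mem_right _ _ (Ideal.pow_mem_pow (Ideal.mem_span_singleton_self _) _)

/-! ### `φ(B⁰_max) ⊆ 𝔸_inf + p·B⁰_max` -/

omit [CharZero F] [IsAdicComplete (Ideal.span {(p : integerC F)}) (integerC F)] in
/-- **`φ(y) ∈ 𝔸_inf + p·B⁰_max` for every `y ∈ B⁰_max`** (`φ(ξ/p) = p^{p−1}(ξ/p)^p + m`, `m ∈ 𝔸_inf`, `p − 1 ≥ 1`).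
[cite: BergerLaurent2002, §1.2] -/
theorem exists_frobBmaxZero_eq_algebraMap_add (y : bmaxZero F p) :
    ∃ (b : Ainf (p := p) F) (z : bmaxZero F p), frobBmaxZero F p y = algebraMap (Ainf (p := p) F) (bmaxZero F p) b + (p : bmaxZero F p) * z := by
  -- membership-free form, by induction over `𝔸_inf[ξ/p]`
  suffices h : ∀ x ∈ bmaxZero F p, ∃ (b : Ainf (p := p) F) (z : Localization.Away (p : Ainf (p := p) F)), z ∈ bmaxZero F p ∧
      frobAinfLoc F p x = algebraMap (Ainf (p := p) F) (Localization.Away (p : Ainf (p := p) F)) b +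
        algebraMap (Ainf (p := p) F) (Localization.Away (p : Ainf (p := p) F)) p * z by
    obtain ⟨b, z, hz, h⟩ := h y y.2
    refine ⟨b, ⟨z, hz⟩, Subtype.ext ?_⟩
    rw [coe_frobBmaxZero, h, Subalgebra.coe_add, Subalgebra.coe_mul, coe_algebraMap_bmaxZero]
    congr 1
    rw [← map_natCast (algebraMap (Ainf (p := p) F) (bmaxZero F p)) p]; rfl
  intro x hx
  have hp2 : 2 ≤ p := (Fact.out : p.Prime).two_le
  refine Algebra.adjoin_induction (fun w hw => ?_) (fun r => ?_) (fun w w' _ _ hw hw' => ?_) (fun w w' _ _ hw hw' => ?_) hx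
  · rw [Set.mem_singleton_iff.1 hw]
    obtain ⟨m, hm⟩ := exists_frobAinfLoc_xiDivP_eq (F := F) (p := p)
    refine ⟨m, algebraMap (Ainf (p := p) F) (Localization.Away (p : Ainf (p := p) F)) ((p : Ainf (p := p) F) ^ (p - 2)) * xiDivP F p ^ p,
      mul_mem (algebraMap_mem_bmaxZero _) (pow_mem xiDivP_mem_bmaxZero p), ?_⟩
    rw [hm, add_comm, ← mul_assoc, ← map_mul, ← pow_succ', show p - 2 + 1 = p - 1 by omega]
  · exact ⟨WittVector.frobenius r, 0, zero_mem _, by rw [frobAinfLoc_algebraMap, mul_zero, add_zero]⟩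
  · obtain ⟨b, z, hz, h⟩ := hw
    obtain ⟨b', z', hz', h'⟩ := hw'
    exact ⟨b + b', z + z', add_mem hz hz', by rw [map_add, h, h', map_add]; ring⟩
  · obtain ⟨b, z, hz, h⟩ := hw
    obtain ⟨b', z', hz', h'⟩ := hw'
    refine ⟨b * b', z * algebraMap (Ainf (p := p) F) (Localization.Away (p : Ainf (p := p) F)) b' +
      algebraMap (Ainf (p := p) F) (Localization.Away (p : Ainf (p := p) F)) b * z' +
      algebraMap (Ainf (p := p) F) (Localization.Away (p : Ainf (p := p) F)) p * (z * z'), ?_, ?_⟩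
    · exact add_mem (add_mem (mul_mem hz (algebraMap_mem_bmaxZero _)) (mul_mem (algebraMap_mem_bmaxZero _) hz'))
        (mul_mem (algebraMap_mem_bmaxZero _) (mul_mem hz hz'))
    · rw [map_mul, h, h', map_mul]; ring

omit [CharZero F] [IsAdicComplete (Ideal.span {(p : integerC F)}) (integerC F)] in
/-- `φ` preserves `pⁿ·B⁰_max`. [folklore] -/
private theorem frobBmaxZero_mem_pow_of_mem {n : ℕ} {w : bmaxZero F p} (hw : w ∈ Ideal.span {(p : bmaxZero F p)} ^ n) :
    frobBmaxZero F p w ∈ Ideal.span {(p : bmaxZero F p)} ^ n := by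
  rw [Ideal.span_singleton_pow, Ideal.mem_span_singleton'] at hw ⊢
  obtain ⟨z, rfl⟩ := hw
  exact ⟨frobBmaxZero F p z, by rw [map_mul, map_pow, frobBmaxZero_natCast]⟩

/-! ### Level `1`: `φ(y) ≡ y (mod p) ⇒ y ≡ r ∈ ℕ (mod p)` -/

set_option maxHeartbeats 400000 in
/-- **Level `1`**: if `y ∈ B⁰_max` and `φ(y) − y ∈ p·B⁰_max` then `y − r ∈ p·B⁰_max` for an integer `0 ≤ r < p`.
(`y ≡ φ(y) ≡ b ∈ 𝔸_inf`; `φ(b) − b ∈ 𝔸_inf ∩ p·B⁰_max = (p, ξ)`; `φ(b) ≡ b^p (mod p)`; so `θ(b)^p ≡ θ(b)`, `θ(b) ≡ r`, `b − r ∈ (p, ξ) ↦ p·B⁰_max`.)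
[cite: Colmez1998Annals, §III.2] -/
theorem exists_nat_sub_natCast_mem_of_frobBmaxZero_sub_mem (hF : Function.Surjective (fontaineTheta (integerC F) p))
    {y : bmaxZero F p} (hy : frobBmaxZero F p y - y ∈ Ideal.span {(p : bmaxZero F p)}) :
    ∃ r : ℕ, r < p ∧ y - (r : bmaxZero F p) ∈ Ideal.span {(p : bmaxZero F p)} := by
  obtain ⟨b, z, hb⟩ := exists_frobBmaxZero_eq_algebraMap_add y
  have hpz : (p : bmaxZero F p) * z ∈ Ideal.span {(p : bmaxZero F p)} := Ideal.mul_mem_right _ _ (Ideal.mem_span_singleton_self _)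
  -- `y ≡ b (mod p)`
  have h1 : y - algebraMap (Ainf (p := p) F) (bmaxZero F p) b ∈ Ideal.span {(p : bmaxZero F p)} := by
    have : y - algebraMap (Ainf (p := p) F) (bmaxZero F p) b = (p : bmaxZero F p) * z - (frobBmaxZero F p y - y) := by rw [hb]; ring
    rw [this]; exact Submodule.sub_mem _ hpz hy
  -- `φ(b) − b ∈ (p, ξ)`
  have h2 : algebraMap (Ainf (p := p) F) (bmaxZero F p) (WittVector.frobenius b - b) ∈ Ideal.span {(p : bmaxZero F p)} := by
    have hφ := frobBmaxZero_mem_pow_of_mem (F := F) (p := p) (n := 1) (w := y - algebraMap (Ainf (p := p) F) (bmaxZero F p) b)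
      (by rw [pow_one]; exact h1)
    rw [pow_one, map_sub, frobBmaxZero_algebraMap] at hφ
    have : algebraMap (Ainf (p := p) F) (bmaxZero F p) (WittVector.frobenius b - b) =
        (frobBmaxZero F p y - y) + (y - algebraMap (Ainf (p := p) F) (bmaxZero F p) b) -
          (frobBmaxZero F p y - algebraMap (Ainf (p := p) F) (bmaxZero F p) (WittVector.frobenius b)) := by
      rw [map_sub]; ring
    rw [this]
    exact Submodule.sub_mem _ (Submodule.add_mem _ hy h1) hφ
  have h3 : WittVector.frobenius b - b ∈ Ideal.span {(p : Ainf (p := p) F), xi} := mem_span_p_xi_of_algebraMap_mem hF h2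
  -- `b^p − b ∈ (p, ξ)`, hence `θ(b)^p − θ(b) ∈ p𝒪`
  have h4 : b ^ p - b ∈ Ideal.span {(p : Ainf (p := p) F), xi} := by
    have h5 : WittVector.frobenius b - b ^ p ∈ Ideal.span {(p : Ainf (p := p) F), xi} :=
      Ideal.span_mono (Set.singleton_subset_iff.2 (Set.mem_insert _ _)) (frobenius_sub_pow_mem_span_p b)
    have : b ^ p - b = (WittVector.frobenius b - b) - (WittVector.frobenius b - b ^ p) := by ring
    rw [this]; exact Submodule.sub_mem _ h3 h5
  have h6 : fontaineTheta (integerC F) p b ^ p - fontaineTheta (integerC F) p b ∈ Ideal.span {(p : integerC F)} := by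
    have := fontaineTheta_mem_span_of_mem_span_p_xi h4
    rwa [map_sub, map_pow] at this
  obtain ⟨r, hr, hr'⟩ := exists_nat_sub_natCast_mem_span_of_pow_sub_mem _ h6
  refine ⟨r, hr, ?_⟩
  -- `b − r ∈ (p, ξ)`, so `y − r = (y − b) + (b − r) ∈ p·B⁰_max`
  have h7 : b - (r : Ainf (p := p) F) ∈ Ideal.span {(p : Ainf (p := p) F), xi} :=
    mem_span_p_xi_of_fontaineTheta_mem hF (by rwa [map_sub, map_natCast])
  have h8 := algebraMap_mem_span_of_mem_span_p_xi h7
  rw [map_sub, map_natCast] at h8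
  have : y - (r : bmaxZero F p) = (y - algebraMap (Ainf (p := p) F) (bmaxZero F p) b) +
      (algebraMap (Ainf (p := p) F) (bmaxZero F p) b - r) := by ring
  rw [this]
  exact Submodule.add_mem _ h1 h8

/-! ### Level `n`: `φ(y) ≡ y (mod pⁿ) ⇒ y ≡ rₙ ∈ ℕ (mod pⁿ)` -/

set_option maxHeartbeats 3200000 in
/-- **Level `n`**: if `y ∈ B⁰_max` and `φ(y) − y ∈ pⁿ·B⁰_max` then `y − r ∈ pⁿ·B⁰_max` for some `r ∈ ℕ` (induction on `n`:
`y = r + pⁿz` with `pⁿ(φ(z) − z) ∈ p^{n+1}B⁰_max`, cancel `pⁿ` in `B⁰_max ⊆ 𝔸_inf[1/p]`, and apply level `1` to `z`). [cite: Colmez1998Annals, §III.2] -/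
theorem exists_natCast_sub_mem_pow_of_frobBmaxZero_sub_mem (hF : Function.Surjective (fontaineTheta (integerC F) p)) (n : ℕ) :
    ∀ {y : bmaxZero F p}, frobBmaxZero F p y - y ∈ Ideal.span {(p : bmaxZero F p)} ^ n →
      ∃ r : ℕ, y - (r : bmaxZero F p) ∈ Ideal.span {(p : bmaxZero F p)} ^ n := by
  induction n with
  | zero => intro y _; exact ⟨0, by rw [pow_zero, Ideal.one_eq_top]; exact Submodule.mem_top⟩
  | succ n ih =>
    intro y hy
    have hyn : frobBmaxZero F p y - y ∈ Ideal.span {(p : bmaxZero F p)} ^ n :=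
      Ideal.pow_le_pow_right (I := Ideal.span {(p : bmaxZero F p)}) (Nat.le_succ n) hy
    obtain ⟨r, hr⟩ := ih hyn
    rw [Ideal.span_singleton_pow, Ideal.mem_span_singleton'] at hr
    obtain ⟨z, hz⟩ := hr
    -- `φ(y) − y = pⁿ (φ z − z)`
    have hφ : frobBmaxZero F p y - y = (p : bmaxZero F p) ^ n * (frobBmaxZero F p z - z) := by
      have hy' : y = z * (p : bmaxZero F p) ^ n + r := by rw [hz, sub_add_cancel]
      rw [hy', map_add, map_mul, map_pow, frobBmaxZero_natCast, frobBmaxZero_natCast]; ring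
    have hy2 := hy
    rw [Ideal.span_singleton_pow, Ideal.mem_span_singleton'] at hy2
    obtain ⟨w, hw⟩ := hy2
    have hz1 : frobBmaxZero F p z - z ∈ Ideal.span {(p : bmaxZero F p)} := by
      refine Ideal.mem_span_singleton'.2 ⟨w, eq_of_natCast_pow_mul_eq (p := p) (F := F) (v := n) ?_⟩
      linear_combination hw + hφ
    obtain ⟨r', -, hr'⟩ := exists_nat_sub_natCast_mem_of_frobBmaxZero_sub_mem (F := F) (p := p) hF (y := z) hz1
    rw [Ideal.mem_span_singleton'] at hr'
    obtain ⟨w', hw'⟩ := hr'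
    refine ⟨r + p ^ n * r', ?_⟩
    rw [Ideal.span_singleton_pow, Ideal.mem_span_singleton']
    refine ⟨w', ?_⟩
    have : y - ((r + p ^ n * r' : ℕ) : bmaxZero F p) = (p : bmaxZero F p) ^ n * (z - r') := by
      rw [Nat.cast_add, Nat.cast_mul, Nat.cast_pow, ← sub_sub, ← hz]; ring
    rw [this, ← hw']; ring

/-! ### `(A_max)^{φ=1} = ℤ_p` -/

omit [CharZero F] [IsAdicComplete (Ideal.span {(p : integerC F)}) (integerC F)] in
/-- `zpToAinf` of `p^n ℤ_p` lands in `pⁿ𝔸_inf ↦ pⁿ·B⁰_max`. [folklore] -/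
private theorem algebraMap_zpToAinf_mem_pow {n : ℕ} {d : ℤ_[p]} (hd : d ∈ Ideal.span {(p : ℤ_[p])} ^ n) :
    algebraMap (Ainf (p := p) F) (bmaxZero F p) (zpToAinf d) ∈ Ideal.span {(p : bmaxZero F p)} ^ n := by
  rw [Ideal.span_singleton_pow, Ideal.mem_span_singleton'] at hd ⊢
  obtain ⟨e, rfl⟩ := hd
  exact ⟨algebraMap (Ainf (p := p) F) (bmaxZero F p) (zpToAinf e), by rw [map_mul, map_mul, map_pow, map_pow, map_natCast, map_natCast]⟩

set_option maxHeartbeats 800000 in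
/-- **The digits of a Frobenius-fixed element**: if `φ(x) = x` in `A_max` then `x mod pⁿ` is the class of an integer.
[cite: Colmez1998Annals, §III.2] -/
theorem exists_evalₐ_eq_natCast_of_frobBmaxPlus_eq (hF : Function.Surjective (fontaineTheta (integerC F) p))
    {x : BmaxPlus F p} (hx : frobBmaxPlus F p x = x) (n : ℕ) :
    ∃ r : ℕ, AdicCompletion.evalₐ (Ideal.span {(p : bmaxZero F p)}) n x = Ideal.Quotient.mk _ (r : bmaxZero F p) := by
  obtain ⟨y, hy⟩ := Ideal.Quotient.mk_surjective (AdicCompletion.evalₐ (Ideal.span {(p : bmaxZero F p)}) n x)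
  have h := evalₐ_frobBmaxPlus_of_eq n hy.symm
  have h1 : AdicCompletion.evalₐ (Ideal.span {(p : bmaxZero F p)}) n (frobBmaxPlus F p x) =
      AdicCompletion.evalₐ (Ideal.span {(p : bmaxZero F p)}) n x := congrArg _ hx
  have h2 : y - frobBmaxZero F p y ∈ Ideal.span {(p : bmaxZero F p)} ^ n :=
    (Ideal.Quotient.eq).1 (hy.trans (h1.symm.trans h))
  obtain ⟨r, hr⟩ := exists_natCast_sub_mem_pow_of_frobBmaxZero_sub_mem hF n (y := y)
    (by rw [← neg_sub]; exact (Ideal.span {(p : bmaxZero F p)} ^ n).neg_mem h2)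
  exact ⟨r, hy.symm.trans ((Ideal.Quotient.eq).2 hr)⟩

set_option maxHeartbeats 800000 in
/-- ★★ **`(A_max)^{φ=1} = ℤ_p`**: an element `x` of Colmez's `A_max = B_max⁺(F)` fixed by Frobenius is the image of a `p`-adic integer,
`x = ι(c)`, `ι : ℤ_p → 𝔸_inf → A_max`. (Levelwise: `x mod pⁿ` is the class of an integer `rₙ`; the `rₙ` are `p`-adically Cauchy
because `pⁿ·B⁰_max ∩ ℤ = pⁿℤ`, and their limit `c ∈ ℤ_p` satisfies `ι(c) = x`.)
[cite: Colmez1998Annals, §III.2] [cite: FontaineAsterisque223III, Exp. III §5.3] -/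
theorem exists_eq_ainfToBmaxPlus_zpToAinf_of_frobBmaxPlus_eq (hF : Function.Surjective (fontaineTheta (integerC F) p))
    {x : BmaxPlus F p} (hx : frobBmaxPlus F p x = x) :
    ∃ c : ℤ_[p], x = ainfToBmaxPlus F p (zpToAinf c) := by
  choose r hr using exists_evalₐ_eq_natCast_of_frobBmaxPlus_eq hF hx
  -- the digits are `p`-adically Cauchy
  have hcauchy : ∀ {m n : ℕ}, m ≤ n →
      (r m : ℤ_[p]) ≡ r n [SMOD (Ideal.span {(p : ℤ_[p])} ^ m • ⊤ : Submodule ℤ_[p] ℤ_[p])] := by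
    intro m n hmn
    have h := factorPow_evalₐ (Ideal.span {(p : bmaxZero F p)}) hmn x
    have e : Ideal.Quotient.mk (Ideal.span {(p : bmaxZero F p)} ^ m) (r n : bmaxZero F p) =
        Ideal.Quotient.mk (Ideal.span {(p : bmaxZero F p)} ^ m) (r m : bmaxZero F p) :=
      calc Ideal.Quotient.mk (Ideal.span {(p : bmaxZero F p)} ^ m) (r n : bmaxZero F p)
          = Ideal.Quotient.factorPow (Ideal.span {(p : bmaxZero F p)}) hmn
              (Ideal.Quotient.mk (Ideal.span {(p : bmaxZero F p)} ^ n) (r n : bmaxZero F p)) :=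
            (Ideal.Quotient.factor_mk _ _).symm
        _ = Ideal.Quotient.factorPow (Ideal.span {(p : bmaxZero F p)}) hmn
              (AdicCompletion.evalₐ (Ideal.span {(p : bmaxZero F p)}) n x) := congrArg _ (hr n).symm
        _ = AdicCompletion.evalₐ (Ideal.span {(p : bmaxZero F p)}) m x := h
        _ = Ideal.Quotient.mk (Ideal.span {(p : bmaxZero F p)} ^ m) (r m : bmaxZero F p) := hr m
    have hmem : (((r n : ℤ) - r m : ℤ) : bmaxZero F p) ∈ Ideal.span {(p : bmaxZero F p)} ^ m := by
      push_cast; exact (Ideal.Quotient.eq).1 e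
    obtain ⟨k, hk⟩ := (intCast_mem_span_bmaxZero_pow_iff hF m _).1 hmem
    rw [smul_eq_mul, Ideal.mul_top, SModEq.sub_mem, Ideal.span_singleton_pow, Ideal.mem_span_singleton']
    refine ⟨-k, ?_⟩
    have hk' := congrArg (fun z : ℤ => (z : ℤ_[p])) hk
    push_cast at hk'
    linear_combination hk'
  haveI : IsAdicComplete (Ideal.span {(p : ℤ_[p])}) ℤ_[p] := by
    rw [← PadicInt.maximalIdeal_eq_span_p]; infer_instance
  obtain ⟨c, hc⟩ := IsPrecomplete.prec (IsAdicComplete.toIsPrecomplete (I := Ideal.span {(p : ℤ_[p])}))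
    (f := fun n => (r n : ℤ_[p])) hcauchy
  refine ⟨c, AdicCompletion.ext_evalₐ fun n => (hr n).trans (Eq.trans ?_ (evalₐ_ainfToBmaxPlus n _).symm)⟩
  have hn := hc n
  rw [smul_eq_mul, Ideal.mul_top, SModEq.sub_mem] at hn
  have h2 := algebraMap_zpToAinf_mem_pow (F := F) hn
  rw [map_sub, map_sub, zpToAinf_natCast, map_natCast] at h2
  exact (Ideal.Quotient.eq).2 h2

/-- **`(A_max)^{φ=1} = ℤ_p`, iff form**: `φ(x) = x ↔ x ∈ ι(ℤ_p)`. [cite: Colmez1998Annals, §III.2] -/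
theorem frobBmaxPlus_eq_self_iff (hF : Function.Surjective (fontaineTheta (integerC F) p)) (x : BmaxPlus F p) :
    frobBmaxPlus F p x = x ↔ ∃ c : ℤ_[p], x = ainfToBmaxPlus F p (zpToAinf c) := by
  refine ⟨exists_eq_ainfToBmaxPlus_zpToAinf_of_frobBmaxPlus_eq hF, ?_⟩
  rintro ⟨c, rfl⟩
  rw [frobBmaxPlus_ainfToBmaxPlus, frobenius_zpToAinf]

end Literature.NumberTheory.PAdicHodge

end
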